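import Summits.BirchSwinnertonDyer.BirchSwinnertonDyer.Theorems.ManinLocalTwoThreeBasisSolveSixtyThree
import HarnessLib

/-!
# Level 63 (C3) pinning, file 2/2: THE CURVE SIDE (two integer solutions: `63a` and the `3`-depleted `21a`) and THE NEWFORM OF EVERY
# `X₀(63)`-DATUM IS `63a` — the FRICKE SIEVE kills the `3`-depleted oldform `ι₁φ₂₁ − ⅓ι₃φ₂₁`

Cell bsd-f2-manin, route `ManinLocalTwoThree` (crux C3 `ManinPrimeToThreeAtNine`, stmt-22968: `3² ∣ 63`), prover seat p2 gen 29; `--supports` (helper).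
ABSTRACT FORM (no `η`-quotient is named here): for ANY twelve forms `C1, …, C12 ∈ M₂(Γ₀(63))` carrying the certified `q`-coefficient table of the
`σ`-closed `η`-basis of `…EtaTablesSixtyThree{A,B,C}` at the sixteen columns `n ∈ {0,…,11,14,22,25,28}` and its Fricke rows `Cᵢ ∣₂ w₆₃ = −Kᵢ·C_σ(i)`,
and for every `X₀(63)`-datum `D` of an elliptic `W/ℚ`:  `toModularForm D.f = Σ xᵢ Cᵢ` with `x = (−2, −2, 16, 0, 0, −54, −14, −12, −49, −7, −8, 16)`
(`f_toModularForm_eq_sixtyThree_of_basis`).  THE MECHANISM: (1) `dim M₂(Γ₀(63)) = g + ν_∞ − 1 = 12` and the twelve forms are independent (pivot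
columns `0,…,10,14`), so `D.f`'s form has coordinates; the space satisfies `a₁₁ = a₂ − a₅ + a₈`, `a₂₂ = a₁ + 5a₄`, `a₂₅ = 3a₁ + 4a₄`,
`a₂₈ = 3a₁ − 3a₄ + 7a₇ + a₁₀`; (2) on the curve (`2, 5 ∤ N_W`, `3 ∣ N_W`, `a₃ = 0` — all from the datum — multiplicativity and Hasse at `2`,
tree `LevelFortyFour.hasse_bounds`): `a₅² = 4a₂²` and `a₂⁴ − 8a₂² + 9 = a₂a₅`, whence `a₂ = ±1`, `a₅ = 2a₂`, `a₄ = −1`, `a₈ = −3a₂`, `a₁₀ = 2`,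
`a₇ = −1`, `a₁₄ = −a₂` (the conjugate pair of `S₂⁽ⁿᵉʷ⁾(63)` would need `a₂² = 3`): TWO integer pivot vectors — `63a` (`a₂ = 1`) and the `3`-depleted
oldform `h = ι₁φ₂₁ − ⅓ι₃φ₂₁` (`a₂ = −1`; `φ₂₁` is NOT an `η`-quotient, so no explicit old witness is available); (3) THE FRICKE SIEVE: `D.f` is a
`w₆₃`-eigenvector (tree `fricke_coords`, p1 g24), the basis is `σ`-closed so `w₆₃` is a signed scaled permutation on coordinates, and `h`'s coordinate
vector `(−⅓, −⅓, 8/3, −⅔, ⅔, −9, −7/3, −2, −7, −1, 0, 4)` violates row `0` for `ε = 1` and row `3` for `ε = −1` — `h` is no eigenvector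
(`w₆₃ι₁φ = 3λι₃φ`-type mixing), while `63a` passes with `ε = −1`.  No newness of any explicit form, no Hecke operator, no Sturm bound.
Nothing here proves C3, Manin's conjecture or BSD. [cite: AtkinLehner1970, Lemma 7, Thm. 3, Thm. 5] [cite: DiamondShurman2005, §5.8, §8.8 (8.44), Thm. 3.5.1]
[cite: CremonaAlgorithms1997, Table 3 (N = 63)] [cite: Ligozat1975, Prop. 3.2.1]
-/

set_option autoImplicit false
-- lint-debt: the directory name repeats the summit name (sibling precedent `ManinLocalTwoThreeNewformPinningFortyFive.lean`)
set_option linter.dupNamespace false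

noncomputable section

open Complex Filter Topology Set Function
open UpperHalfPlane hiding I
open scoped Real Topology MatrixGroups ModularForm
open ModularForm CongruenceSubgroup
open Literature.NumberTheory.ModularForms
open Literature.NumberTheory.EllipticCurves Literature.NumberTheory.EllipticCurves.ModularForms

namespace Summit.BirchSwinnertonDyer.BirchSwinnertonDyer.Theorems.ManinLocalTwoThree.LevelSixtyThree

open NewformPinningFiftySix (dvd_conductorNorm_iff lFunction_eq_zero_of_sq_dvd)
open LevelFortyFour (lFunction_four lFunction_eight hasse_bounds)
open LevelFiftyTwo (lFunction_mul lFunction_prime_sq fricke_coords)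

/-! ## §2 The curve side at level 63: two integer pivot vectors -/

section CurveSide

variable (W : WeierstrassCurve ℚ) [W.IsElliptic]

set_option maxHeartbeats 400000 in
/-- **The curve side of the level-63 pinning.**  For an elliptic `W/ℚ` with `2 ∤ N_W`, `5 ∤ N_W`, `3 ∣ N_W`, `a₃ = 0` (all fact-free from an `X₀(63)`-datum)
whose `aₙ` satisfy the four column relations of `M₂(Γ₀(63))`: `a₄ = −1`, `a₆ = a₉ = 0`, `a₇ = −1`, `a₁₀ = 2` and `(a₂, a₅, a₈, a₁₄) = (1, 2, −3, −1)` (`63a`)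
or `(−1, −2, 3, 1)` (the `3`-depleted `21a`).  Integers, multiplicativity at `2, 5, 7, 11`, the recursion at `2², 2³, 3², 5²`, and Hasse at `2` only.
[cite: DiamondShurman2005, §8.8 (8.44)] [cite: SilvermanAEC2009, Thm. V.1.1] -/
theorem curveSide_sixtyThree (h2N : ¬ 2 ∣ W.conductorNorm ℤ) (h5N : ¬ 5 ∣ W.conductorNorm ℤ) (h3N : 3 ∣ W.conductorNorm ℤ)
    (ha3 : W.LFunction 3 = 0)
    (r11 : W.LFunction 11 = W.LFunction 2 - W.LFunction 5 + W.LFunction 8)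
    (r22 : W.LFunction 22 = W.LFunction 1 + 5 * W.LFunction 4)
    (r25 : W.LFunction 25 = 3 * W.LFunction 1 + 4 * W.LFunction 4)
    (r28 : W.LFunction 28 = 3 * W.LFunction 1 - 3 * W.LFunction 4 + 7 * W.LFunction 7 + W.LFunction 10) :
    W.LFunction 0 = 0 ∧ W.LFunction 1 = 1 ∧ W.LFunction 3 = 0 ∧ W.LFunction 4 = -1 ∧ W.LFunction 6 = 0 ∧ W.LFunction 7 = -1 ∧
      W.LFunction 9 = 0 ∧ W.LFunction 10 = 2 ∧
      ((W.LFunction 2 = 1 ∧ W.LFunction 5 = 2 ∧ W.LFunction 8 = -3 ∧ W.LFunction 14 = -1) ∨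
       (W.LFunction 2 = -1 ∧ W.LFunction 5 = -2 ∧ W.LFunction 8 = 3 ∧ W.LFunction 14 = 1)) := by
  have a0 : W.LFunction 0 = 0 := ArithmeticFunction.map_zero
  have a1 : W.LFunction 1 = 1 := WeierstrassCurve.LFunction_apply_one W
  have a4 : W.LFunction 4 = W.LFunction 2 * W.LFunction 2 - 2 := by
    have h := lFunction_four W; rw [if_neg h2N] at h; exact h
  have a8 : W.LFunction 8 = W.LFunction 2 * W.LFunction 4 - 2 * W.LFunction 2 := by
    have h := lFunction_eight W; rw [if_neg h2N] at h; exact h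
  have a6 : W.LFunction 6 = W.LFunction 2 * W.LFunction 3 := lFunction_mul W (show Nat.Coprime 2 3 by norm_num)
  have a9 : W.LFunction 9 = W.LFunction 3 * W.LFunction 3 := by
    have h := lFunction_prime_sq W Nat.prime_three; rw [if_pos h3N, sub_zero] at h; exact h
  have a10 : W.LFunction 10 = W.LFunction 2 * W.LFunction 5 := lFunction_mul W (show Nat.Coprime 2 5 by norm_num)
  have a14 : W.LFunction 14 = W.LFunction 2 * W.LFunction 7 := lFunction_mul W (show Nat.Coprime 2 7 by norm_num)
  have a22 : W.LFunction 22 = W.LFunction 2 * W.LFunction 11 := lFunction_mul W (show Nat.Coprime 2 11 by norm_num)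
  have a25 : W.LFunction 25 = W.LFunction 5 * W.LFunction 5 - 5 := by
    have h := lFunction_prime_sq W (show Nat.Prime 5 by norm_num); rw [if_neg h5N] at h; exact_mod_cast h
  have a28 : W.LFunction 28 = W.LFunction 4 * W.LFunction 7 := lFunction_mul W (show Nat.Coprime 4 7 by norm_num)
  obtain ⟨⟨hs1, hs2⟩, -, -, -⟩ := hasse_bounds W
  rw [ha3] at a6 a9
  simp only [mul_zero] at a6 a9
  -- the two key integer equations in `s = a₂`, `r = a₅`
  generalize hs : W.LFunction 2 = s at *
  generalize hr : W.LFunction 5 = r at *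
  generalize hq : W.LFunction 7 = q at *
  rw [a1] at r22 r25 r28
  have hr2 : r * r = 4 * (s * s) := by nlinarith [r25, a25, a4]
  have hkey : s * (s - r + (s * (s * s - 2) - 2 * s)) = 1 + 5 * (s * s - 2) := by
    rw [a22, r11, a8, a4] at r22
    -- `r22 : s * (s - r + (s * (s*s-2) - 2*s)) = 1 + 5*(s*s - 2)` up to the shape produced by the rewrites
    linarith [r22]
  have hs' : s = -2 ∨ s = -1 ∨ s = 0 ∨ s = 1 ∨ s = 2 := by omega
  rcases hs' with rfl | rfl | rfl | rfl | rfl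
  · -- `s = -2`: `r² = 16`, `hkey : -2(-2 - r + (-4 + 4)) = 11` ⟹ `4 + 2r = 11`, no integer solution
    exfalso; omega
  · -- `s = -1`: `r² = 4`, `hkey` ⟹ `r = -2`
    have hr' : r = -2 := by nlinarith [hkey, hr2]
    subst hr'
    have hq' : q = -1 := by nlinarith [r28, a28, a4, a10]
    subst hq'
    refine ⟨a0, a1, ha3, by linarith [a4], a6, rfl, a9, by linarith [a10], Or.inr ⟨rfl, rfl, by linarith [a8, a4], by linarith [a14]⟩⟩
  · exfalso; omega
  · have hr' : r = 2 := by nlinarith [hkey, hr2]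
    subst hr'
    have hq' : q = -1 := by nlinarith [r28, a28, a4, a10]
    subst hq'
    refine ⟨a0, a1, ha3, by linarith [a4], a6, rfl, a9, by linarith [a10], Or.inl ⟨rfl, rfl, by linarith [a8, a4], by linarith [a14]⟩⟩
  · exfalso; omega

end CurveSide

/-! ## §3 The pinning: coordinates of the two candidates, the Fricke sieve, the conclusion -/

section Pinning

variable {C1 C2 C3 C4 C5 C6 C7 C8 C9 C10 C11 C12 : ModularForm (Gamma0 63) 2}
  (h1 : (qExpansion 1 ⇑C1).coeff 0 = (0 : ℂ) ∧ (qExpansion 1 ⇑C1).coeff 1 = (0 : ℂ) ∧ (qExpansion 1 ⇑C1).coeff 2 = (0 : ℂ) ∧ (qExpansion 1 ⇑C1).coeff 3 = (0 : ℂ) ∧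
      (qExpansion 1 ⇑C1).coeff 4 = (1 : ℂ) ∧ (qExpansion 1 ⇑C1).coeff 5 = (2 : ℂ) ∧ (qExpansion 1 ⇑C1).coeff 6 = (5 : ℂ) ∧ (qExpansion 1 ⇑C1).coeff 7 = (4 : ℂ) ∧
      (qExpansion 1 ⇑C1).coeff 8 = (8 : ℂ) ∧ (qExpansion 1 ⇑C1).coeff 9 = (6 : ℂ) ∧ (qExpansion 1 ⇑C1).coeff 10 = (14 : ℂ) ∧ (qExpansion 1 ⇑C1).coeff 11 = (6 : ℂ) ∧
      (qExpansion 1 ⇑C1).coeff 14 = (17 : ℂ) ∧ (qExpansion 1 ⇑C1).coeff 22 = (5 : ℂ) ∧ (qExpansion 1 ⇑C1).coeff 25 = (4 : ℂ) ∧ (qExpansion 1 ⇑C1).coeff 28 = (39 : ℂ))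
  (h2 : (qExpansion 1 ⇑C2).coeff 0 = (1 : ℂ) ∧ (qExpansion 1 ⇑C2).coeff 1 = (-2 : ℂ) ∧ (qExpansion 1 ⇑C2).coeff 2 = (-1 : ℂ) ∧ (qExpansion 1 ⇑C2).coeff 3 = (4 : ℂ) ∧
      (qExpansion 1 ⇑C2).coeff 4 = (-3 : ℂ) ∧ (qExpansion 1 ⇑C2).coeff 5 = (0 : ℂ) ∧ (qExpansion 1 ⇑C2).coeff 6 = (7 : ℂ) ∧ (qExpansion 1 ⇑C2).coeff 7 = (-6 : ℂ) ∧
      (qExpansion 1 ⇑C2).coeff 8 = (-7 : ℂ) ∧ (qExpansion 1 ⇑C2).coeff 9 = (10 : ℂ) ∧ (qExpansion 1 ⇑C2).coeff 10 = (-2 : ℂ) ∧ (qExpansion 1 ⇑C2).coeff 11 = (-8 : ℂ) ∧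
      (qExpansion 1 ⇑C2).coeff 14 = (-18 : ℂ) ∧ (qExpansion 1 ⇑C2).coeff 22 = (-17 : ℂ) ∧ (qExpansion 1 ⇑C2).coeff 25 = (-18 : ℂ) ∧ (qExpansion 1 ⇑C2).coeff 28 = (-41 : ℂ))
  (h3 : (qExpansion 1 ⇑C3).coeff 0 = (1 : ℂ) ∧ (qExpansion 1 ⇑C3).coeff 1 = (1 : ℂ) ∧ (qExpansion 1 ⇑C3).coeff 2 = (2 : ℂ) ∧ (qExpansion 1 ⇑C3).coeff 3 = (1 : ℂ) ∧
      (qExpansion 1 ⇑C3).coeff 4 = (3 : ℂ) ∧ (qExpansion 1 ⇑C3).coeff 5 = (3 : ℂ) ∧ (qExpansion 1 ⇑C3).coeff 6 = (4 : ℂ) ∧ (qExpansion 1 ⇑C3).coeff 7 = (3 : ℂ) ∧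
      (qExpansion 1 ⇑C3).coeff 8 = (5 : ℂ) ∧ (qExpansion 1 ⇑C3).coeff 9 = (4 : ℂ) ∧ (qExpansion 1 ⇑C3).coeff 10 = (7 : ℂ) ∧ (qExpansion 1 ⇑C3).coeff 11 = (4 : ℂ) ∧
      (qExpansion 1 ⇑C3).coeff 14 = (9 : ℂ) ∧ (qExpansion 1 ⇑C3).coeff 22 = (16 : ℂ) ∧ (qExpansion 1 ⇑C3).coeff 25 = (15 : ℂ) ∧ (qExpansion 1 ⇑C3).coeff 28 = (22 : ℂ))
  (h4 : (qExpansion 1 ⇑C4).coeff 0 = (0 : ℂ) ∧ (qExpansion 1 ⇑C4).coeff 1 = (0 : ℂ) ∧ (qExpansion 1 ⇑C4).coeff 2 = (0 : ℂ) ∧ (qExpansion 1 ⇑C4).coeff 3 = (1 : ℂ) ∧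
      (qExpansion 1 ⇑C4).coeff 4 = (1 : ℂ) ∧ (qExpansion 1 ⇑C4).coeff 5 = (2 : ℂ) ∧ (qExpansion 1 ⇑C4).coeff 6 = (-1 : ℂ) ∧ (qExpansion 1 ⇑C4).coeff 7 = (1 : ℂ) ∧
      (qExpansion 1 ⇑C4).coeff 8 = (-1 : ℂ) ∧ (qExpansion 1 ⇑C4).coeff 9 = (1 : ℂ) ∧ (qExpansion 1 ⇑C4).coeff 10 = (-4 : ℂ) ∧ (qExpansion 1 ⇑C4).coeff 11 = (-3 : ℂ) ∧
      (qExpansion 1 ⇑C4).coeff 14 = (-1 : ℂ) ∧ (qExpansion 1 ⇑C4).coeff 22 = (5 : ℂ) ∧ (qExpansion 1 ⇑C4).coeff 25 = (4 : ℂ) ∧ (qExpansion 1 ⇑C4).coeff 28 = (0 : ℂ))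
  (h5 : (qExpansion 1 ⇑C5).coeff 0 = (0 : ℂ) ∧ (qExpansion 1 ⇑C5).coeff 1 = (1 : ℂ) ∧ (qExpansion 1 ⇑C5).coeff 2 = (-1 : ℂ) ∧ (qExpansion 1 ⇑C5).coeff 3 = (-1 : ℂ) ∧
      (qExpansion 1 ⇑C5).coeff 4 = (0 : ℂ) ∧ (qExpansion 1 ⇑C5).coeff 5 = (0 : ℂ) ∧ (qExpansion 1 ⇑C5).coeff 6 = (1 : ℂ) ∧ (qExpansion 1 ⇑C5).coeff 7 = (0 : ℂ) ∧
      (qExpansion 1 ⇑C5).coeff 8 = (2 : ℂ) ∧ (qExpansion 1 ⇑C5).coeff 9 = (-1 : ℂ) ∧ (qExpansion 1 ⇑C5).coeff 10 = (-2 : ℂ) ∧ (qExpansion 1 ⇑C5).coeff 11 = (1 : ℂ) ∧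
      (qExpansion 1 ⇑C5).coeff 14 = (0 : ℂ) ∧ (qExpansion 1 ⇑C5).coeff 22 = (1 : ℂ) ∧ (qExpansion 1 ⇑C5).coeff 25 = (3 : ℂ) ∧ (qExpansion 1 ⇑C5).coeff 28 = (1 : ℂ))
  (h6 : (qExpansion 1 ⇑C6).coeff 0 = (0 : ℂ) ∧ (qExpansion 1 ⇑C6).coeff 1 = (0 : ℂ) ∧ (qExpansion 1 ⇑C6).coeff 2 = (1 : ℂ) ∧ (qExpansion 1 ⇑C6).coeff 3 = (0 : ℂ) ∧
      (qExpansion 1 ⇑C6).coeff 4 = (0 : ℂ) ∧ (qExpansion 1 ⇑C6).coeff 5 = (2 : ℂ) ∧ (qExpansion 1 ⇑C6).coeff 6 = (0 : ℂ) ∧ (qExpansion 1 ⇑C6).coeff 7 = (0 : ℂ) ∧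
      (qExpansion 1 ⇑C6).coeff 8 = (5 : ℂ) ∧ (qExpansion 1 ⇑C6).coeff 9 = (0 : ℂ) ∧ (qExpansion 1 ⇑C6).coeff 10 = (0 : ℂ) ∧ (qExpansion 1 ⇑C6).coeff 11 = (4 : ℂ) ∧
      (qExpansion 1 ⇑C6).coeff 14 = (8 : ℂ) ∧ (qExpansion 1 ⇑C6).coeff 22 = (0 : ℂ) ∧ (qExpansion 1 ⇑C6).coeff 25 = (0 : ℂ) ∧ (qExpansion 1 ⇑C6).coeff 28 = (0 : ℂ))
  (h7 : (qExpansion 1 ⇑C7).coeff 0 = (1 : ℂ) ∧ (qExpansion 1 ⇑C7).coeff 1 = (0 : ℂ) ∧ (qExpansion 1 ⇑C7).coeff 2 = (0 : ℂ) ∧ (qExpansion 1 ⇑C7).coeff 3 = (0 : ℂ) ∧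
      (qExpansion 1 ⇑C7).coeff 4 = (0 : ℂ) ∧ (qExpansion 1 ⇑C7).coeff 5 = (0 : ℂ) ∧ (qExpansion 1 ⇑C7).coeff 6 = (0 : ℂ) ∧ (qExpansion 1 ⇑C7).coeff 7 = (-6 : ℂ) ∧
      (qExpansion 1 ⇑C7).coeff 8 = (0 : ℂ) ∧ (qExpansion 1 ⇑C7).coeff 9 = (0 : ℂ) ∧ (qExpansion 1 ⇑C7).coeff 10 = (0 : ℂ) ∧ (qExpansion 1 ⇑C7).coeff 11 = (0 : ℂ) ∧
      (qExpansion 1 ⇑C7).coeff 14 = (9 : ℂ) ∧ (qExpansion 1 ⇑C7).coeff 22 = (0 : ℂ) ∧ (qExpansion 1 ⇑C7).coeff 25 = (0 : ℂ) ∧ (qExpansion 1 ⇑C7).coeff 28 = (-42 : ℂ))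
  (h8 : (qExpansion 1 ⇑C8).coeff 0 = (0 : ℂ) ∧ (qExpansion 1 ⇑C8).coeff 1 = (1 : ℂ) ∧ (qExpansion 1 ⇑C8).coeff 2 = (0 : ℂ) ∧ (qExpansion 1 ⇑C8).coeff 3 = (0 : ℂ) ∧
      (qExpansion 1 ⇑C8).coeff 4 = (1 : ℂ) ∧ (qExpansion 1 ⇑C8).coeff 5 = (0 : ℂ) ∧ (qExpansion 1 ⇑C8).coeff 6 = (0 : ℂ) ∧ (qExpansion 1 ⇑C8).coeff 7 = (2 : ℂ) ∧
      (qExpansion 1 ⇑C8).coeff 8 = (-3 : ℂ) ∧ (qExpansion 1 ⇑C8).coeff 9 = (0 : ℂ) ∧ (qExpansion 1 ⇑C8).coeff 10 = (0 : ℂ) ∧ (qExpansion 1 ⇑C8).coeff 11 = (-3 : ℂ) ∧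
      (qExpansion 1 ⇑C8).coeff 14 = (-6 : ℂ) ∧ (qExpansion 1 ⇑C8).coeff 22 = (6 : ℂ) ∧ (qExpansion 1 ⇑C8).coeff 25 = (7 : ℂ) ∧ (qExpansion 1 ⇑C8).coeff 28 = (14 : ℂ))
  (h9 : (qExpansion 1 ⇑C9).coeff 0 = (0 : ℂ) ∧ (qExpansion 1 ⇑C9).coeff 1 = (0 : ℂ) ∧ (qExpansion 1 ⇑C9).coeff 2 = (0 : ℂ) ∧ (qExpansion 1 ⇑C9).coeff 3 = (0 : ℂ) ∧
      (qExpansion 1 ⇑C9).coeff 4 = (0 : ℂ) ∧ (qExpansion 1 ⇑C9).coeff 5 = (0 : ℂ) ∧ (qExpansion 1 ⇑C9).coeff 6 = (0 : ℂ) ∧ (qExpansion 1 ⇑C9).coeff 7 = (1 : ℂ) ∧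
      (qExpansion 1 ⇑C9).coeff 8 = (0 : ℂ) ∧ (qExpansion 1 ⇑C9).coeff 9 = (0 : ℂ) ∧ (qExpansion 1 ⇑C9).coeff 10 = (0 : ℂ) ∧ (qExpansion 1 ⇑C9).coeff 11 = (0 : ℂ) ∧
      (qExpansion 1 ⇑C9).coeff 14 = (-3 : ℂ) ∧ (qExpansion 1 ⇑C9).coeff 22 = (0 : ℂ) ∧ (qExpansion 1 ⇑C9).coeff 25 = (0 : ℂ) ∧ (qExpansion 1 ⇑C9).coeff 28 = (7 : ℂ))
  (h10 : (qExpansion 1 ⇑C10).coeff 0 = (0 : ℂ) ∧ (qExpansion 1 ⇑C10).coeff 1 = (1 : ℂ) ∧ (qExpansion 1 ⇑C10).coeff 2 = (-3 : ℂ) ∧ (qExpansion 1 ⇑C10).coeff 3 = (0 : ℂ) ∧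
      (qExpansion 1 ⇑C10).coeff 4 = (7 : ℂ) ∧ (qExpansion 1 ⇑C10).coeff 5 = (-6 : ℂ) ∧ (qExpansion 1 ⇑C10).coeff 6 = (0 : ℂ) ∧ (qExpansion 1 ⇑C10).coeff 7 = (8 : ℂ) ∧
      (qExpansion 1 ⇑C10).coeff 8 = (-15 : ℂ) ∧ (qExpansion 1 ⇑C10).coeff 9 = (0 : ℂ) ∧ (qExpansion 1 ⇑C10).coeff 10 = (18 : ℂ) ∧ (qExpansion 1 ⇑C10).coeff 11 = (-12 : ℂ) ∧
      (qExpansion 1 ⇑C10).coeff 14 = (-24 : ℂ) ∧ (qExpansion 1 ⇑C10).coeff 22 = (36 : ℂ) ∧ (qExpansion 1 ⇑C10).coeff 25 = (31 : ℂ) ∧ (qExpansion 1 ⇑C10).coeff 28 = (56 : ℂ))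
  (h11 : (qExpansion 1 ⇑C11).coeff 0 = (0 : ℂ) ∧ (qExpansion 1 ⇑C11).coeff 1 = (0 : ℂ) ∧ (qExpansion 1 ⇑C11).coeff 2 = (0 : ℂ) ∧ (qExpansion 1 ⇑C11).coeff 3 = (1 : ℂ) ∧
      (qExpansion 1 ⇑C11).coeff 4 = (-1 : ℂ) ∧ (qExpansion 1 ⇑C11).coeff 5 = (-1 : ℂ) ∧ (qExpansion 1 ⇑C11).coeff 6 = (1 : ℂ) ∧ (qExpansion 1 ⇑C11).coeff 7 = (-1 : ℂ) ∧
      (qExpansion 1 ⇑C11).coeff 8 = (0 : ℂ) ∧ (qExpansion 1 ⇑C11).coeff 9 = (2 : ℂ) ∧ (qExpansion 1 ⇑C11).coeff 10 = (-3 : ℂ) ∧ (qExpansion 1 ⇑C11).coeff 11 = (1 : ℂ) ∧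
      (qExpansion 1 ⇑C11).coeff 14 = (3 : ℂ) ∧ (qExpansion 1 ⇑C11).coeff 22 = (-5 : ℂ) ∧ (qExpansion 1 ⇑C11).coeff 25 = (-4 : ℂ) ∧ (qExpansion 1 ⇑C11).coeff 28 = (-7 : ℂ))
  (h12 : (qExpansion 1 ⇑C12).coeff 0 = (0 : ℂ) ∧ (qExpansion 1 ⇑C12).coeff 1 = (0 : ℂ) ∧ (qExpansion 1 ⇑C12).coeff 2 = (0 : ℂ) ∧ (qExpansion 1 ⇑C12).coeff 3 = (0 : ℂ) ∧
      (qExpansion 1 ⇑C12).coeff 4 = (0 : ℂ) ∧ (qExpansion 1 ⇑C12).coeff 5 = (1 : ℂ) ∧ (qExpansion 1 ⇑C12).coeff 6 = (-2 : ℂ) ∧ (qExpansion 1 ⇑C12).coeff 7 = (-1 : ℂ) ∧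
      (qExpansion 1 ⇑C12).coeff 8 = (3 : ℂ) ∧ (qExpansion 1 ⇑C12).coeff 9 = (-1 : ℂ) ∧ (qExpansion 1 ⇑C12).coeff 10 = (1 : ℂ) ∧ (qExpansion 1 ⇑C12).coeff 11 = (2 : ℂ) ∧
      (qExpansion 1 ⇑C12).coeff 14 = (3 : ℂ) ∧ (qExpansion 1 ⇑C12).coeff 22 = (0 : ℂ) ∧ (qExpansion 1 ⇑C12).coeff 25 = (0 : ℂ) ∧ (qExpansion 1 ⇑C12).coeff 28 = (-6 : ℂ))
include h1 h2 h3 h4 h5 h6 h7 h8 h9 h10 h11 h12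

omit h1 h2 h3 h4 h5 h6 h7 h8 h9 h10 h11 h12 in
/-- The coefficients of the modular form underlying `D.f` are the curve's `aₙ`. [folklore] -/
theorem coeff_toModularForm_f63 {W : WeierstrassCurve ℚ} [W.IsElliptic] (D : ModularParametrizationData W 63) (n : ℕ) :
    (qExpansion 1 ⇑(CuspForm.toModularFormₗ D.f)).coeff n = (W.LFunction n : ℂ) := by
  have hcoe : (⇑(CuspForm.toModularFormₗ D.f) : ℍ → ℂ) = ⇑D.f := funext (CuspForm.toModularFormₗ_apply D.f)
  rw [hcoe]
  exact D.isNewformOf.2 n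

/-- **THE NEWFORM OF EVERY `X₀(63)`-DATUM IS `63a = Σ xᵢCᵢ`** on any twelve forms of `M₂(Γ₀(63))` with the certified columns and Fricke rows of the
`σ`-closed `η`-basis — FACT-FREE (`M₂`-linear algebra + curve recursion + the FRICKE SIEVE). [cite: AtkinLehner1970, Thm. 3, Thm. 5]
[cite: DiamondShurman2005, Thm. 3.5.1, §5.8] [cite: CremonaAlgorithms1997, Table 3 (N = 63)] -/
theorem f_toModularForm_eq_sixtyThree_of_basis {W : WeierstrassCurve ℚ} [W.IsElliptic] (D : ModularParametrizationData W 63)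
    (w1 : (⇑C1 : ℍ → ℂ) ∣[(2 : ℤ)] (glCast (frickeGL 63 : GL (Fin 2) ℚ) : GL (Fin 2) ℝ) = ((-1 : ℂ)) • (⇑C2 : ℍ → ℂ))
    (w2 : (⇑C2 : ℍ → ℂ) ∣[(2 : ℤ)] (glCast (frickeGL 63 : GL (Fin 2) ℚ) : GL (Fin 2) ℝ) = ((-1 : ℂ)) • (⇑C1 : ℍ → ℂ))
    (w3 : (⇑C3 : ℍ → ℂ) ∣[(2 : ℤ)] (glCast (frickeGL 63 : GL (Fin 2) ℚ) : GL (Fin 2) ℝ) = ((-1 : ℂ)) • (⇑C3 : ℍ → ℂ))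
    (w4 : (⇑C4 : ℍ → ℂ) ∣[(2 : ℤ)] (glCast (frickeGL 63 : GL (Fin 2) ℚ) : GL (Fin 2) ℝ) = ((-1 : ℂ)) • (⇑C5 : ℍ → ℂ))
    (w5 : (⇑C5 : ℍ → ℂ) ∣[(2 : ℤ)] (glCast (frickeGL 63 : GL (Fin 2) ℚ) : GL (Fin 2) ℝ) = ((-1 : ℂ)) • (⇑C4 : ℍ → ℂ))
    (w6 : (⇑C6 : ℍ → ℂ) ∣[(2 : ℤ)] (glCast (frickeGL 63 : GL (Fin 2) ℚ) : GL (Fin 2) ℝ) = (((-7 : ℂ) / 27)) • (⇑C7 : ℍ → ℂ))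
    (w7 : (⇑C7 : ℍ → ℂ) ∣[(2 : ℤ)] (glCast (frickeGL 63 : GL (Fin 2) ℚ) : GL (Fin 2) ℝ) = (((-27 : ℂ) / 7)) • (⇑C6 : ℍ → ℂ))
    (w8 : (⇑C8 : ℍ → ℂ) ∣[(2 : ℤ)] (glCast (frickeGL 63 : GL (Fin 2) ℚ) : GL (Fin 2) ℝ) = ((-1 : ℂ)) • (⇑C8 : ℍ → ℂ))
    (w9 : (⇑C9 : ℍ → ℂ) ∣[(2 : ℤ)] (glCast (frickeGL 63 : GL (Fin 2) ℚ) : GL (Fin 2) ℝ) = (((-1 : ℂ) / 7)) • (⇑C10 : ℍ → ℂ))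
    (w10 : (⇑C10 : ℍ → ℂ) ∣[(2 : ℤ)] (glCast (frickeGL 63 : GL (Fin 2) ℚ) : GL (Fin 2) ℝ) = ((-7 : ℂ)) • (⇑C9 : ℍ → ℂ))
    (w11 : (⇑C11 : ℍ → ℂ) ∣[(2 : ℤ)] (glCast (frickeGL 63 : GL (Fin 2) ℚ) : GL (Fin 2) ℝ) = ((-1 : ℂ)) • (⇑C11 : ℍ → ℂ))
    (w12 : (⇑C12 : ℍ → ℂ) ∣[(2 : ℤ)] (glCast (frickeGL 63 : GL (Fin 2) ℚ) : GL (Fin 2) ℝ) = ((-1 : ℂ)) • (⇑C12 : ℍ → ℂ)) :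
    CuspForm.toModularFormₗ D.f = ∑ i, ![(-2 : ℂ), (-2 : ℂ), (16 : ℂ), (0 : ℂ), (0 : ℂ), (-54 : ℂ), (-14 : ℂ), (-12 : ℂ), (-49 : ℂ), (-7 : ℂ), (-8 : ℂ), (16 : ℂ)] i • ![C1, C2, C3, C4, C5, C6, C7, C8, C9, C10, C11, C12] i := by
  have hF := coeff_toModularForm_f63 D
  obtain ⟨c, hc⟩ := exists_coords63 h1 h2 h3 h4 h5 h6 h7 h8 h9 h10 h11 h12 (CuspForm.toModularFormₗ D.f)
  obtain ⟨q11, q22, q25, q28⟩ := columnRelations63 h1 h2 h3 h4 h5 h6 h7 h8 h9 h10 h11 h12 (CuspForm.toModularFormₗ D.f)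
  simp only [hF] at q11 q22 q25 q28
  have r11 : W.LFunction 11 = W.LFunction 2 - W.LFunction 5 + W.LFunction 8 := by exact_mod_cast q11
  have r22 : W.LFunction 22 = W.LFunction 1 + 5 * W.LFunction 4 := by exact_mod_cast q22
  have r25 : W.LFunction 25 = 3 * W.LFunction 1 + 4 * W.LFunction 4 := by exact_mod_cast q25
  have r28 : W.LFunction 28 = 3 * W.LFunction 1 - 3 * W.LFunction 4 + 7 * W.LFunction 7 + W.LFunction 10 := by exact_mod_cast q28
  have h2N : ¬ 2 ∣ W.conductorNorm ℤ := fun h ↦ absurd ((dvd_conductorNorm_iff D Nat.prime_two).mp h) (by norm_num)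
  have h5N : ¬ 5 ∣ W.conductorNorm ℤ := fun h ↦ absurd ((dvd_conductorNorm_iff D (by norm_num : Nat.Prime 5)).mp h) (by norm_num)
  have h3N : 3 ∣ W.conductorNorm ℤ := (dvd_conductorNorm_iff D Nat.prime_three).mpr (by norm_num)
  have ha3 : W.LFunction 3 = 0 := lFunction_eq_zero_of_sq_dvd D Nat.prime_three (by norm_num)
  obtain ⟨a0, a1, a3, a4, a6, a7, a9, a10, hcase⟩ := curveSide_sixtyThree W h2N h5N h3N ha3 r11 r22 r25 r28
  obtain ⟨p0, p1, p2, p3, p4, p5, p6, p7, p8, p9, p10, p14⟩ := coeff_pivots_sixtyThreeA h1 h2 h3 h4 h5 h6 h7 h8 h9 h10 h11 h12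
  rcases hcase with ⟨a2, a5, a8, a14⟩ | ⟨a2, a5, a8, a14⟩
  · -- `63a`
    rw [hc]
    refine eq_of_pivots63 h1 h2 h3 h4 h5 h6 h7 h8 h9 h10 h11 h12 c _ fun n hn ↦ ?_
    rw [← hc]
    simp only [Finset.mem_insert, Finset.mem_singleton] at hn
    rcases hn with rfl | rfl | rfl | rfl | rfl | rfl | rfl | rfl | rfl | rfl | rfl | rfl
    · rw [hF, p0, a0]; norm_num
    · rw [hF, p1, a1]; norm_num
    · rw [hF, p2, a2]; norm_num
    · rw [hF, p3, a3]; norm_num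
    · rw [hF, p4, a4]; norm_num
    · rw [hF, p5, a5]; norm_num
    · rw [hF, p6, a6]; norm_num
    · rw [hF, p7, a7]; norm_num
    · rw [hF, p8, a8]; norm_num
    · rw [hF, p9, a9]; norm_num
    · rw [hF, p10, a10]; norm_num
    · rw [hF, p14, a14]; norm_num
  · -- the `3`-depleted oldform: coordinates `y`, then the Fricke sieve
    exfalso
    obtain ⟨o0, o1, o2, o3, o4, o5, o6, o7, o8, o9, o10, o14⟩ := coeff_pivots_old63 h1 h2 h3 h4 h5 h6 h7 h8 h9 h10 h11 h12
    have hold : CuspForm.toModularFormₗ D.f = ∑ i, ![((-1 : ℂ) / 3), ((-1 : ℂ) / 3), ((8 : ℂ) / 3), ((-2 : ℂ) / 3), ((2 : ℂ) / 3), (-9 : ℂ), ((-7 : ℂ) / 3), (-2 : ℂ), (-7 : ℂ), (-1 : ℂ), (0 : ℂ), (4 : ℂ)] i • ![C1, C2, C3, C4, C5, C6, C7, C8, C9, C10, C11, C12] i := by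
      rw [hc]
      refine eq_of_pivots63 h1 h2 h3 h4 h5 h6 h7 h8 h9 h10 h11 h12 c _ fun n hn ↦ ?_
      rw [← hc]
      simp only [Finset.mem_insert, Finset.mem_singleton] at hn
      rcases hn with rfl | rfl | rfl | rfl | rfl | rfl | rfl | rfl | rfl | rfl | rfl | rfl
      · rw [hF, o0, a0]; norm_num
      · rw [hF, o1, a1]; norm_num
      · rw [hF, o2, a2]; norm_num
      · rw [hF, o3, a3]; norm_num
      · rw [hF, o4, a4]; norm_num
      · rw [hF, o5, a5]; norm_num
      · rw [hF, o6, a6]; norm_num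
      · rw [hF, o7, a7]; norm_num
      · rw [hF, o8, a8]; norm_num
      · rw [hF, o9, a9]; norm_num
      · rw [hF, o10, a10]; norm_num
      · rw [hF, o14, a14]; norm_num
    -- as functions: `⇑D.f = Σ yᵢ ⇑Cᵢ`
    have hfun : (⇑D.f : ℍ → ℂ) = ∑ i, ![((-1 : ℂ) / 3), ((-1 : ℂ) / 3), ((8 : ℂ) / 3), ((-2 : ℂ) / 3), ((2 : ℂ) / 3), (-9 : ℂ), ((-7 : ℂ) / 3), (-2 : ℂ), (-7 : ℂ), (-1 : ℂ), (0 : ℂ), (4 : ℂ)] i • (fun i ↦ (⇑(![C1, C2, C3, C4, C5, C6, C7, C8, C9, C10, C11, C12] i) : ℍ → ℂ)) i := by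
      have h := congrArg (fun H : ModularForm (Gamma0 63) 2 ↦ (⇑H : ℍ → ℂ)) hold
      have hF' : (⇑(CuspForm.toModularFormₗ D.f) : ℍ → ℂ) = ⇑D.f := _root_.funext (CuspForm.toModularFormₗ_apply D.f)
      simp only [hF', coe_sum_smul63] at h
      exact h
    -- linear independence of the coerced family
    have hLI : LinearIndependent ℂ (fun i ↦ (⇑(![C1, C2, C3, C4, C5, C6, C7, C8, C9, C10, C11, C12] i) : ℍ → ℂ)) := by
      rw [Fintype.linearIndependent_iff]
      intro d hd
      have h0 : (∑ i, d i • ![C1, C2, C3, C4, C5, C6, C7, C8, C9, C10, C11, C12] i) = 0 := by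
        apply DFunLike.coe_injective
        rw [coe_sum_smul63]
        simpa using hd
      exact Fintype.linearIndependent_iff.mp (linearIndependent63 h1 h2 h3 h4 h5 h6 h7 h8 h9 h10 h11 h12) d h0
    -- the Fricke rows of the family: a signed scaled permutation
    have hW : ∀ i : Fin 12, (fun i ↦ (⇑(![C1, C2, C3, C4, C5, C6, C7, C8, C9, C10, C11, C12] i) : ℍ → ℂ)) i ∣[(2 : ℤ)] (glCast (frickeGL 63 : GL (Fin 2) ℚ) : GL (Fin 2) ℝ)
        = ∑ j, (![![(0 : ℂ), (-1 : ℂ), (0 : ℂ), (0 : ℂ), (0 : ℂ), (0 : ℂ), (0 : ℂ), (0 : ℂ), (0 : ℂ), (0 : ℂ), (0 : ℂ), (0 : ℂ)],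
      ![(-1 : ℂ), (0 : ℂ), (0 : ℂ), (0 : ℂ), (0 : ℂ), (0 : ℂ), (0 : ℂ), (0 : ℂ), (0 : ℂ), (0 : ℂ), (0 : ℂ), (0 : ℂ)],
      ![(0 : ℂ), (0 : ℂ), (-1 : ℂ), (0 : ℂ), (0 : ℂ), (0 : ℂ), (0 : ℂ), (0 : ℂ), (0 : ℂ), (0 : ℂ), (0 : ℂ), (0 : ℂ)],
      ![(0 : ℂ), (0 : ℂ), (0 : ℂ), (0 : ℂ), (-1 : ℂ), (0 : ℂ), (0 : ℂ), (0 : ℂ), (0 : ℂ), (0 : ℂ), (0 : ℂ), (0 : ℂ)],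
      ![(0 : ℂ), (0 : ℂ), (0 : ℂ), (-1 : ℂ), (0 : ℂ), (0 : ℂ), (0 : ℂ), (0 : ℂ), (0 : ℂ), (0 : ℂ), (0 : ℂ), (0 : ℂ)],
      ![(0 : ℂ), (0 : ℂ), (0 : ℂ), (0 : ℂ), (0 : ℂ), (0 : ℂ), ((-27 : ℂ) / 7), (0 : ℂ), (0 : ℂ), (0 : ℂ), (0 : ℂ), (0 : ℂ)],
      ![(0 : ℂ), (0 : ℂ), (0 : ℂ), (0 : ℂ), (0 : ℂ), ((-7 : ℂ) / 27), (0 : ℂ), (0 : ℂ), (0 : ℂ), (0 : ℂ), (0 : ℂ), (0 : ℂ)],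
      ![(0 : ℂ), (0 : ℂ), (0 : ℂ), (0 : ℂ), (0 : ℂ), (0 : ℂ), (0 : ℂ), (-1 : ℂ), (0 : ℂ), (0 : ℂ), (0 : ℂ), (0 : ℂ)],
      ![(0 : ℂ), (0 : ℂ), (0 : ℂ), (0 : ℂ), (0 : ℂ), (0 : ℂ), (0 : ℂ), (0 : ℂ), (0 : ℂ), (-7 : ℂ), (0 : ℂ), (0 : ℂ)],
      ![(0 : ℂ), (0 : ℂ), (0 : ℂ), (0 : ℂ), (0 : ℂ), (0 : ℂ), (0 : ℂ), (0 : ℂ), ((-1 : ℂ) / 7), (0 : ℂ), (0 : ℂ), (0 : ℂ)],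
      ![(0 : ℂ), (0 : ℂ), (0 : ℂ), (0 : ℂ), (0 : ℂ), (0 : ℂ), (0 : ℂ), (0 : ℂ), (0 : ℂ), (0 : ℂ), (-1 : ℂ), (0 : ℂ)],
      ![(0 : ℂ), (0 : ℂ), (0 : ℂ), (0 : ℂ), (0 : ℂ), (0 : ℂ), (0 : ℂ), (0 : ℂ), (0 : ℂ), (0 : ℂ), (0 : ℂ), (-1 : ℂ)]] : Fin 12 → Fin 12 → ℂ) j i • (fun i ↦ (⇑(![C1, C2, C3, C4, C5, C6, C7, C8, C9, C10, C11, C12] i) : ℍ → ℂ)) j := by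
      intro i
      fin_cases i <;>
        simp only [Fin.sum_univ_succ, Fin.sum_univ_zero, Matrix.cons_val_zero, Matrix.cons_val_succ, Matrix.cons_val, Fin.isValue,
          Fin.zero_eta, Fin.mk_one, Fin.reduceFinMk, zero_smul, add_zero, zero_add, w1, w2, w3, w4, w5, w6, w7, w8, w9, w10, w11, w12]
    obtain ⟨ε, hε, hrow⟩ := fricke_coords D (fun i ↦ (⇑(![C1, C2, C3, C4, C5, C6, C7, C8, C9, C10, C11, C12] i) : ℍ → ℂ)) hLI (![((-1 : ℂ) / 3), ((-1 : ℂ) / 3), ((8 : ℂ) / 3), ((-2 : ℂ) / 3), ((2 : ℂ) / 3), (-9 : ℂ), ((-7 : ℂ) / 3), (-2 : ℂ), (-7 : ℂ), (-1 : ℂ), (0 : ℂ), (4 : ℂ)]) hfun (![![(0 : ℂ), (-1 : ℂ), (0 : ℂ), (0 : ℂ), (0 : ℂ), (0 : ℂ), (0 : ℂ), (0 : ℂ), (0 : ℂ), (0 : ℂ), (0 : ℂ), (0 : ℂ)],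
      ![(-1 : ℂ), (0 : ℂ), (0 : ℂ), (0 : ℂ), (0 : ℂ), (0 : ℂ), (0 : ℂ), (0 : ℂ), (0 : ℂ), (0 : ℂ), (0 : ℂ), (0 : ℂ)],
      ![(0 : ℂ), (0 : ℂ), (-1 : ℂ), (0 : ℂ), (0 : ℂ), (0 : ℂ), (0 : ℂ), (0 : ℂ), (0 : ℂ), (0 : ℂ), (0 : ℂ), (0 : ℂ)],
      ![(0 : ℂ), (0 : ℂ), (0 : ℂ), (0 : ℂ), (-1 : ℂ), (0 : ℂ), (0 : ℂ), (0 : ℂ), (0 : ℂ), (0 : ℂ), (0 : ℂ), (0 : ℂ)],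
      ![(0 : ℂ), (0 : ℂ), (0 : ℂ), (-1 : ℂ), (0 : ℂ), (0 : ℂ), (0 : ℂ), (0 : ℂ), (0 : ℂ), (0 : ℂ), (0 : ℂ), (0 : ℂ)],
      ![(0 : ℂ), (0 : ℂ), (0 : ℂ), (0 : ℂ), (0 : ℂ), (0 : ℂ), ((-27 : ℂ) / 7), (0 : ℂ), (0 : ℂ), (0 : ℂ), (0 : ℂ), (0 : ℂ)],
      ![(0 : ℂ), (0 : ℂ), (0 : ℂ), (0 : ℂ), (0 : ℂ), ((-7 : ℂ) / 27), (0 : ℂ), (0 : ℂ), (0 : ℂ), (0 : ℂ), (0 : ℂ), (0 : ℂ)],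
      ![(0 : ℂ), (0 : ℂ), (0 : ℂ), (0 : ℂ), (0 : ℂ), (0 : ℂ), (0 : ℂ), (-1 : ℂ), (0 : ℂ), (0 : ℂ), (0 : ℂ), (0 : ℂ)],
      ![(0 : ℂ), (0 : ℂ), (0 : ℂ), (0 : ℂ), (0 : ℂ), (0 : ℂ), (0 : ℂ), (0 : ℂ), (0 : ℂ), (-7 : ℂ), (0 : ℂ), (0 : ℂ)],
      ![(0 : ℂ), (0 : ℂ), (0 : ℂ), (0 : ℂ), (0 : ℂ), (0 : ℂ), (0 : ℂ), (0 : ℂ), ((-1 : ℂ) / 7), (0 : ℂ), (0 : ℂ), (0 : ℂ)],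
      ![(0 : ℂ), (0 : ℂ), (0 : ℂ), (0 : ℂ), (0 : ℂ), (0 : ℂ), (0 : ℂ), (0 : ℂ), (0 : ℂ), (0 : ℂ), (-1 : ℂ), (0 : ℂ)],
      ![(0 : ℂ), (0 : ℂ), (0 : ℂ), (0 : ℂ), (0 : ℂ), (0 : ℂ), (0 : ℂ), (0 : ℂ), (0 : ℂ), (0 : ℂ), (0 : ℂ), (-1 : ℂ)]]) hW
    have e0 := hrow 0
    have e3 := hrow 3
    simp only [Fin.sum_univ_succ, Fin.sum_univ_zero, Matrix.cons_val_zero, Matrix.cons_val_succ, Matrix.cons_val, Fin.isValue] at e0 e3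
    rcases hε with rfl | rfl
    · norm_num at e0
    · norm_num at e3

end Pinning

end Summit.BirchSwinnertonDyer.BirchSwinnertonDyer.Theorems.ManinLocalTwoThree.LevelSixtyThree

end
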